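import Summits.QuantumFields.YangMills.Theorems.ColdStartUniversalityLatticeLangevinGeneratorInvariance
import Summits.QuantumFields.YangMills.Theorems.ColdStartUniversalityLatticeLangevinGeneratorCalculus
import HarnessLib

/-!
# Route `ColdStartUniversality` (fixed-cut-off package): the SZZ generator is SYMMETRIC and NONPOSITIVE on `L²(μ_{β'})`

Helper file (seat `ym-line-csu-p1`, g15).  SZZ (CMP 400 (2023) §3, p. 13) state `𝓔^L(F,G) = -∫ 𝓛_L F G dμ` for smooth `F, G` and
that `P_t^L` is the `L²(μ)`-semigroup of `𝓔^L`.  For the SU(2) system on `(ℤ/L)³`, any `β'`, and the tree's coordinate generator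
`𝓛` (`dynkin_forward`) on `C³` compactly supported functions of the real link coordinates — WITHOUT integration by parts:
* ★ `integral_mul_generator_symm` — `∫ (g∘coords)·𝓛f dμ_{β'} = ∫ (f∘coords)·𝓛g dμ_{β'}` (derivative at `τ = 0⁺` of the detailed
  balance `integral_mul_transition_symm_su2` through Dynkin's formula);
* ★ `two_mul_integral_mul_generator_eq_neg_carre` — `2 ∫ F·𝓛f dμ = -∫ Γ(f,f) dμ`, `Γ(f,f) = Σ_{ij} ∂_i f ∂_j f Σ_n σ_{in} σ_{jn}`
  (infinitesimal invariance on `f²` + Leibniz `generator_mul`); ★ `integral_mul_generator_self_nonpos` — `∫ F·𝓛f dμ ≤ 0`;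
* ★ `tendsto_dirichletForm_semigroup` — `τ⁻¹ (∫ F P_τ F dμ - ∫ F² dμ) → ∫ F·𝓛f dμ` as `τ ↓ 0`.
THEOREMS ONLY, no definition, no sorry.  RECORD-rung R3 plumbing (fixed cut-off); nothing here bears on the Yang–Mills mass gap.
-/

set_option autoImplicit false

noncomputable section

namespace Summit.QuantumFields.YangMills.Theorems.ColdStartUniversality

open MeasureTheory ProbabilityTheory Finset Filter Set Topology
open scoped BigOperators NNReal ENNReal
open Literature.Probability.Process Literature.MathematicalPhysics.QuantumFieldTheory
open Literature.MathematicalPhysics.QuantumLattice (fundamentalRep fundamentalLatticeRep continuous_fundamentalRep)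

variable {L : ℕ} [NeZero L]

/-- **Slope form of the fundamental theorem of calculus at `0⁺`** for a continuous `φ : ℝ → ℝ`:
`τ⁻¹ ∫₀^τ φ → φ 0` as `τ ↓ 0`. [folklore] -/
theorem tendsto_inv_mul_intervalIntegral_of_continuous {φ : ℝ → ℝ} (hφ : Continuous φ) :
    Tendsto (fun τ : ℝ => τ⁻¹ * ∫ r in (0 : ℝ)..τ, φ r) (𝓝[>] 0) (𝓝 (φ 0)) := by
  have hD : HasDerivAt (fun u => ∫ r in (0 : ℝ)..u, φ r) (φ 0) 0 := intervalIntegral.integral_hasDerivAt_right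
    (hφ.intervalIntegrable _ _) (hφ.stronglyMeasurableAtFilter _ _) hφ.continuousAt
  refine hD.tendsto_slope_zero_right.congr' (Eventually.of_forall fun τ => ?_)
  simp only [zero_add, intervalIntegral.integral_same, sub_zero, smul_eq_mul]

/-- Two continuous functions with equal integrals over `[0, τ]` for all `τ > 0` agree at `0`. [folklore] -/
theorem eq_at_zero_of_intervalIntegral_eq {φ ψ : ℝ → ℝ} (hφ : Continuous φ) (hψ : Continuous ψ)
    (h : ∀ τ : ℝ, 0 < τ → ∫ r in (0 : ℝ)..τ, φ r = ∫ r in (0 : ℝ)..τ, ψ r) : φ 0 = ψ 0 := by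
  have h1' : Tendsto (fun τ : ℝ => τ⁻¹ * ∫ r in (0 : ℝ)..τ, ψ r) (𝓝[>] 0) (𝓝 (φ 0)) := by
    refine (tendsto_inv_mul_intervalIntegral_of_continuous hφ).congr' ?_
    filter_upwards [self_mem_nhdsWithin] with τ hτ
    rw [h τ hτ]
  exact tendsto_nhds_unique h1' (tendsto_inv_mul_intervalIntegral_of_continuous hψ)

/-- ★ **The SZZ generator is symmetric with respect to the Wilson measure**: for `C³` compactly supported `f, g` of the real
link coordinates, `∫ (g∘coords) · 𝓛f dμ_{β'} = ∫ (f∘coords) · 𝓛g dμ_{β'}` — the derivative at `τ = 0⁺` of the detailed balance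
`∫ G · P_τ F dμ = ∫ F · P_τ G dμ` through Dynkin's formula. [cite: ShenZhuZhu2022, §3 (𝓔^L(F,G) = -∫ 𝓛_L F G dμ, p. 13)] -/
theorem integral_mul_generator_symm (L : ℕ) [NeZero L] (β' : ℝ)
    {f g : (Edge 3 L × Fin 2 × Fin 2 × Bool → ℝ) → ℝ} (hf : ContDiff ℝ 3 f) (hfc : HasCompactSupport f)
    (hg : ContDiff ℝ 3 g) (hgc : HasCompactSupport g) :
    let coords : GaugeConfig 3 L (Matrix.specialUnitaryGroup (Fin 2) ℂ) → (Edge 3 L × Fin 2 × Fin 2 × Bool → ℝ) :=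
      fun V q => (fun z : ℂ => if q.2.2.2 then z.im else z.re)
        ((fundamentalRep (Fin 2) (V q.1) : Matrix (Fin 2) (Fin 2) ℂ) q.2.1 q.2.2.1)
    let gen : ((Edge 3 L × Fin 2 × Fin 2 × Bool → ℝ) → ℝ) → GaugeConfig 3 L (Matrix.specialUnitaryGroup (Fin 2) ℂ) → ℝ :=
      fun h V =>
      (∑ i : Edge 3 L × Fin 2 × Fin 2 × Bool, fderiv ℝ h (coords V) (Pi.single i 1) *
          (fun z : ℂ => if i.2.2.2 then z.im else z.re)
            ((latticeLangevinDynamics (fundamentalLatticeRep 2) β').drift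
              (matrixConfig (fundamentalRep (Fin 2)) V) i.1 i.2.1 i.2.2.1) +
      1 / 2 * ∑ i : Edge 3 L × Fin 2 × Fin 2 × Bool, ∑ j : Edge 3 L × Fin 2 × Fin 2 × Bool,
        fderiv ℝ (fun z => fderiv ℝ h z (Pi.single i 1)) (coords V) (Pi.single j 1) *
          ∑ n : Edge 3 L × NoiseIdx 2,
            (if n.1 = i.1 then (fun z : ℂ => if i.2.2.2 then z.im else z.re)
              ((latticeLangevinDynamics (fundamentalLatticeRep 2) β').noise
                (matrixConfig (fundamentalRep (Fin 2)) V) i.1 n.2 i.2.1 i.2.2.1) else 0) *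
            (if n.1 = j.1 then (fun z : ℂ => if j.2.2.2 then z.im else z.re)
              ((latticeLangevinDynamics (fundamentalLatticeRep 2) β').noise
                (matrixConfig (fundamentalRep (Fin 2)) V) j.1 n.2 j.2.1 j.2.2.1) else 0))
    ∫ V, g (coords V) * gen f V ∂(wilsonMeasure (d := 3) (L := L) (fundamentalRep (Fin 2)) β') =
      ∫ V, f (coords V) * gen g V ∂(wilsonMeasure (d := 3) (L := L) (fundamentalRep (Fin 2)) β') := by
  intro coords gen
  classical
  haveI := secondCountableTopology_su2
  haveI := borelSpace_config L
  set μ : Measure (GaugeConfig 3 L (Matrix.specialUnitaryGroup (Fin 2) ℂ)) :=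
    wilsonMeasure (d := 3) (L := L) (fundamentalRep (Fin 2)) β' with hμ
  haveI : IsProbabilityMeasure μ :=
    isProbabilityMeasure_wilsonMeasure (d := 3) (L := L) (fundamentalRep (Fin 2)) (continuous_fundamentalRep (Fin 2)) β'
  obtain ⟨κ, hκ, hκ0, hreal⟩ := exists_transitionKernel L β'
  haveI := hκ
  have hco : Continuous coords := continuous_coords (L := L)
  have hFc : Continuous fun V => f (coords V) := hf.continuous.comp hco
  have hGc : Continuous fun V => g (coords V) := hg.continuous.comp hco
  have hgf : Continuous (gen f) := continuous_generator (L := L) β' (hf.of_le (by norm_num))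
  have hgg : Continuous (gen g) := continuous_generator (L := L) β' (hg.of_le (by norm_num))
  -- Dynkin in kernel form for `f` and `g`
  have hDf : ∀ x, ∀ {τ : ℝ}, 0 ≤ τ →
      ∫ y, f (coords y) ∂(κ τ.toNNReal x) = f (coords x) + ∫ r in (0 : ℝ)..τ, (∫ y, gen f y ∂(κ r.toNNReal x)) :=
    fun x τ hτ => transitionKernel_dynkin (L := L) β' κ hreal hf hfc x hτ
  have hDg : ∀ x, ∀ {τ : ℝ}, 0 ≤ τ →
      ∫ y, g (coords y) ∂(κ τ.toNNReal x) = g (coords x) + ∫ r in (0 : ℝ)..τ, (∫ y, gen g y ∂(κ r.toNNReal x)) :=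
    fun x τ hτ => transitionKernel_dynkin (L := L) β' κ hreal hg hgc x hτ
  -- the jointly continuous integrands `(r, x) ↦ G(x) κ_r(𝓛f)(x)` and `(r, x) ↦ F(x) κ_r(𝓛g)(x)`
  have hJf : Continuous (Function.uncurry fun (r : ℝ) (x : GaugeConfig 3 L (Matrix.specialUnitaryGroup (Fin 2) ℂ)) =>
      g (coords x) * ∫ y, gen f y ∂(κ r.toNNReal x)) :=
    (hGc.comp continuous_snd).mul ((continuous_transitionKernel_action β' κ hreal hgf).comp
      ((continuous_real_toNNReal.comp continuous_fst).prodMk continuous_snd))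
  have hJg : Continuous (Function.uncurry fun (r : ℝ) (x : GaugeConfig 3 L (Matrix.specialUnitaryGroup (Fin 2) ℂ)) =>
      f (coords x) * ∫ y, gen g y ∂(κ r.toNNReal x)) :=
    (hFc.comp continuous_snd).mul ((continuous_transitionKernel_action β' κ hreal hgg).comp
      ((continuous_real_toNNReal.comp continuous_fst).prodMk continuous_snd))
  set φ : ℝ → ℝ := fun r => ∫ x, g (coords x) * ∫ y, gen f y ∂(κ r.toNNReal x) ∂μ with hφ
  set ψ : ℝ → ℝ := fun r => ∫ x, f (coords x) * ∫ y, gen g y ∂(κ r.toNNReal x) ∂μ with hψ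
  have hφc : Continuous φ := continuous_integral_of_continuous_uncurry μ hJf
  have hψc : Continuous ψ := continuous_integral_of_continuous_uncurry μ hJg
  -- detailed balance at time `τ`, expanded by Dynkin
  have hbal : ∀ τ : ℝ, 0 < τ → ∫ r in (0 : ℝ)..τ, φ r = ∫ r in (0 : ℝ)..τ, ψ r := by
    intro τ hτ
    have hsym := integral_mul_transition_symm_su2 L β' κ hreal τ.toNNReal hGc hFc
    have hIf : Continuous fun x : GaugeConfig 3 L (Matrix.specialUnitaryGroup (Fin 2) ℂ) =>
        ∫ r in (0 : ℝ)..τ, g (coords x) * ∫ y, gen f y ∂(κ r.toNNReal x) := by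
      have h' : Continuous (Function.uncurry fun (x : GaugeConfig 3 L (Matrix.specialUnitaryGroup (Fin 2) ℂ)) (r : ℝ) =>
          g (coords x) * ∫ y, gen f y ∂(κ r.toNNReal x)) := hJf.comp continuous_swap
      exact intervalIntegral.continuous_parametric_intervalIntegral_of_continuous' h' 0 τ
    have hIg : Continuous fun x : GaugeConfig 3 L (Matrix.specialUnitaryGroup (Fin 2) ℂ) =>
        ∫ r in (0 : ℝ)..τ, f (coords x) * ∫ y, gen g y ∂(κ r.toNNReal x) := by
      have h' : Continuous (Function.uncurry fun (x : GaugeConfig 3 L (Matrix.specialUnitaryGroup (Fin 2) ℂ)) (r : ℝ) =>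
          f (coords x) * ∫ y, gen g y ∂(κ r.toNNReal x)) := hJg.comp continuous_swap
      exact intervalIntegral.continuous_parametric_intervalIntegral_of_continuous' h' 0 τ
    have eL : ∫ x, g (coords x) * (∫ y, f (coords y) ∂(κ τ.toNNReal x)) ∂μ =
        (∫ x, g (coords x) * f (coords x) ∂μ) + ∫ r in (0 : ℝ)..τ, φ r := by
      have hpt : ∀ x, g (coords x) * (∫ y, f (coords y) ∂(κ τ.toNNReal x)) =
          g (coords x) * f (coords x) + ∫ r in (0 : ℝ)..τ, g (coords x) * ∫ y, gen f y ∂(κ r.toNNReal x) := by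
        intro x; rw [hDf x hτ.le, mul_add, intervalIntegral.integral_const_mul]
      rw [integral_congr_ae (Eventually.of_forall hpt), integral_add (integrable_of_continuous_of_compactSpace (f := fun V => g (coords V) * f (coords V)) (hGc.mul hFc) μ)
        (integrable_of_continuous_of_compactSpace hIf μ), integral_intervalIntegral_swap_of_continuous μ hJf hτ.le]
    have eR : ∫ x, f (coords x) * (∫ y, g (coords y) ∂(κ τ.toNNReal x)) ∂μ =
        (∫ x, f (coords x) * g (coords x) ∂μ) + ∫ r in (0 : ℝ)..τ, ψ r := by
      have hpt : ∀ x, f (coords x) * (∫ y, g (coords y) ∂(κ τ.toNNReal x)) =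
          f (coords x) * g (coords x) + ∫ r in (0 : ℝ)..τ, f (coords x) * ∫ y, gen g y ∂(κ r.toNNReal x) := by
        intro x; rw [hDg x hτ.le, mul_add, intervalIntegral.integral_const_mul]
      rw [integral_congr_ae (Eventually.of_forall hpt), integral_add (integrable_of_continuous_of_compactSpace (f := fun V => f (coords V) * g (coords V)) (hFc.mul hGc) μ)
        (integrable_of_continuous_of_compactSpace hIg μ), integral_intervalIntegral_swap_of_continuous μ hJg hτ.le]
    have hFG : ∫ x, g (coords x) * f (coords x) ∂μ = ∫ x, f (coords x) * g (coords x) ∂μ :=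
      integral_congr_ae (Eventually.of_forall fun x => mul_comm _ _)
    have h := hsym
    rw [eL, eR, hFG] at h
    linarith
  have h0 := eq_at_zero_of_intervalIntegral_eq hφc hψc hbal
  have hκ0x : ∀ (x : GaugeConfig 3 L (Matrix.specialUnitaryGroup (Fin 2) ℂ))
      {u : GaugeConfig 3 L (Matrix.specialUnitaryGroup (Fin 2) ℂ) → ℝ}, ∫ y, u y ∂(κ (0 : ℝ).toNNReal x) = u x := by
    intro x u
    rw [Real.toNNReal_zero, hκ0, Kernel.id_apply, integral_dirac]
  have e1 : φ 0 = ∫ x, g (coords x) * gen f x ∂μ :=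
    integral_congr_ae (Eventually.of_forall fun x => by simp only [hκ0x])
  have e2 : ψ 0 = ∫ x, f (coords x) * gen g x ∂μ :=
    integral_congr_ae (Eventually.of_forall fun x => by simp only [hκ0x])
  rw [← e1, ← e2, h0]

/-- ★ **Energy identity (carré du champ)**: for a `C³` compactly supported `f` of the real link coordinates,
`2 ∫ (f∘coords) · 𝓛f dμ_{β'} = -∫ Γ(f,f)∘coords dμ_{β'}` with `Γ(f,f) = Σ_{ij} ∂_i f ∂_j f Σ_n σ_{in} σ_{jn}` — infinitesimal invariance
on `f²` and the Leibniz rule `𝓛(f²) = 2 f 𝓛f + Γ(f,f)`. [cite: ShenZhuZhu2022, §3 (Dirichlet form 𝓔^L, p. 13)] -/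
theorem two_mul_integral_mul_generator_eq_neg_carre (L : ℕ) [NeZero L] (β' : ℝ)
    {f : (Edge 3 L × Fin 2 × Fin 2 × Bool → ℝ) → ℝ} (hf : ContDiff ℝ 3 f) (hfc : HasCompactSupport f) :
    let coords : GaugeConfig 3 L (Matrix.specialUnitaryGroup (Fin 2) ℂ) → (Edge 3 L × Fin 2 × Fin 2 × Bool → ℝ) :=
      fun V q => (fun z : ℂ => if q.2.2.2 then z.im else z.re)
        ((fundamentalRep (Fin 2) (V q.1) : Matrix (Fin 2) (Fin 2) ℂ) q.2.1 q.2.2.1)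
    let b : GaugeConfig 3 L (Matrix.specialUnitaryGroup (Fin 2) ℂ) → (Edge 3 L × Fin 2 × Fin 2 × Bool) → ℝ := fun V i =>
      (fun z : ℂ => if i.2.2.2 then z.im else z.re)
        ((latticeLangevinDynamics (fundamentalLatticeRep 2) β').drift (matrixConfig (fundamentalRep (Fin 2)) V) i.1 i.2.1 i.2.2.1)
    let A : GaugeConfig 3 L (Matrix.specialUnitaryGroup (Fin 2) ℂ) → (Edge 3 L × Fin 2 × Fin 2 × Bool) →
        (Edge 3 L × Fin 2 × Fin 2 × Bool) → ℝ := fun V i j =>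
      ∑ n : Edge 3 L × NoiseIdx 2,
        (if n.1 = i.1 then (fun z : ℂ => if i.2.2.2 then z.im else z.re)
          ((latticeLangevinDynamics (fundamentalLatticeRep 2) β').noise
            (matrixConfig (fundamentalRep (Fin 2)) V) i.1 n.2 i.2.1 i.2.2.1) else 0) *
        (if n.1 = j.1 then (fun z : ℂ => if j.2.2.2 then z.im else z.re)
          ((latticeLangevinDynamics (fundamentalLatticeRep 2) β').noise
            (matrixConfig (fundamentalRep (Fin 2)) V) j.1 n.2 j.2.1 j.2.2.1) else 0)
    let gen : ((Edge 3 L × Fin 2 × Fin 2 × Bool → ℝ) → ℝ) → GaugeConfig 3 L (Matrix.specialUnitaryGroup (Fin 2) ℂ) → ℝ :=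
      fun h V =>
      (∑ i : Edge 3 L × Fin 2 × Fin 2 × Bool, fderiv ℝ h (coords V) (Pi.single i 1) * b V i +
      1 / 2 * ∑ i : Edge 3 L × Fin 2 × Fin 2 × Bool, ∑ j : Edge 3 L × Fin 2 × Fin 2 × Bool,
        fderiv ℝ (fun z => fderiv ℝ h z (Pi.single i 1)) (coords V) (Pi.single j 1) * A V i j)
    2 * ∫ V, f (coords V) * gen f V ∂(wilsonMeasure (d := 3) (L := L) (fundamentalRep (Fin 2)) β') =
      -∫ V, (∑ i : Edge 3 L × Fin 2 × Fin 2 × Bool, ∑ j : Edge 3 L × Fin 2 × Fin 2 × Bool,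
        fderiv ℝ f (coords V) (Pi.single i 1) * fderiv ℝ f (coords V) (Pi.single j 1) * A V i j)
        ∂(wilsonMeasure (d := 3) (L := L) (fundamentalRep (Fin 2)) β') := by
  intro coords b A gen
  classical
  haveI := secondCountableTopology_su2
  haveI := borelSpace_config L
  set μ : Measure (GaugeConfig 3 L (Matrix.specialUnitaryGroup (Fin 2) ℂ)) :=
    wilsonMeasure (d := 3) (L := L) (fundamentalRep (Fin 2)) β' with hμ
  haveI : IsProbabilityMeasure μ :=
    isProbabilityMeasure_wilsonMeasure (d := 3) (L := L) (fundamentalRep (Fin 2)) (continuous_fundamentalRep (Fin 2)) β'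
  have hco : Continuous coords := continuous_coords (L := L)
  have hFc : Continuous fun V => f (coords V) := hf.continuous.comp hco
  have hgf : Continuous (gen f) := continuous_generator (L := L) β' (hf.of_le (by norm_num))
  have hf2 : ContDiff ℝ 3 (fun z => f z * f z) := hf.mul hf
  have hf2c : HasCompactSupport (fun z => f z * f z) := hfc.mul_left
  have hinv := integral_generator_wilson_eq_zero L β' hf2 hf2c
  have hgf2 : Continuous (gen fun z => f z * f z) := continuous_generator (L := L) β' (hf2.of_le (by norm_num))
  -- Leibniz: `𝓛(f²) = 2 f 𝓛f + Γ(f,f)` pointwise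
  have hA : ∀ V i j, A V i j = A V j i := fun V i j =>
    Finset.sum_congr rfl fun n _ => mul_comm _ _
  have hleib : ∀ V, gen (fun z => f z * f z) V = 2 * (f (coords V) * gen f V) +
      ∑ i, ∑ j, fderiv ℝ f (coords V) (Pi.single i 1) * fderiv ℝ f (coords V) (Pi.single j 1) * A V i j := by
    intro V
    have h := generator_mul (fun i : Edge 3 L × Fin 2 × Fin 2 × Bool => (Pi.single i (1 : ℝ) : _ → ℝ)) (b V) (A V) (hA V)
      (hf.of_le (by norm_num)) (hf.of_le (by norm_num)) (coords V)
    show (∑ i, fderiv ℝ (fun z => f z * f z) (coords V) (Pi.single i 1) * b V i +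
      1 / 2 * ∑ i, ∑ j, fderiv ℝ (fun z => fderiv ℝ (fun z' => f z' * f z') z (Pi.single i 1)) (coords V) (Pi.single j 1) *
        A V i j) = 2 * (f (coords V) * (∑ i, fderiv ℝ f (coords V) (Pi.single i 1) * b V i +
      1 / 2 * ∑ i, ∑ j, fderiv ℝ (fun z => fderiv ℝ f z (Pi.single i 1)) (coords V) (Pi.single j 1) * A V i j)) +
      ∑ i, ∑ j, fderiv ℝ f (coords V) (Pi.single i 1) * fderiv ℝ f (coords V) (Pi.single j 1) * A V i j
    rw [h]; ring
  have hΓc : Continuous fun V => ∑ i, ∑ j, fderiv ℝ f (coords V) (Pi.single i 1) * fderiv ℝ f (coords V) (Pi.single j 1) * A V i j := by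
    have h : (fun V => ∑ i, ∑ j, fderiv ℝ f (coords V) (Pi.single i 1) * fderiv ℝ f (coords V) (Pi.single j 1) * A V i j) =
        fun V => gen (fun z => f z * f z) V - 2 * (f (coords V) * gen f V) := by
      funext V; rw [hleib V]; ring
    rw [h]
    exact hgf2.sub (continuous_const.mul (hFc.mul hgf))
  have e : ∫ V, gen (fun z => f z * f z) V ∂μ =
      2 * (∫ V, f (coords V) * gen f V ∂μ) +
        ∫ V, (∑ i, ∑ j, fderiv ℝ f (coords V) (Pi.single i 1) * fderiv ℝ f (coords V) (Pi.single j 1) * A V i j) ∂μ := by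
    rw [integral_congr_ae (Eventually.of_forall hleib), integral_add ((integrable_of_continuous_of_compactSpace (f := fun V => f (coords V) * gen f V) (hFc.mul hgf) μ).const_mul 2)
      (integrable_of_continuous_of_compactSpace hΓc μ), integral_const_mul]
  have hinv' : ∫ V, gen (fun z => f z * f z) V ∂μ = 0 := hinv
  linarith

/-- ★ **The SZZ generator is nonpositive on `L²(μ_{β'})`**: `∫ (f∘coords) · 𝓛f dμ_{β'} ≤ 0` for `C³` compactly supported `f`
(`Γ(f,f) = Σ_n (Σ_i ∂_i f σ_{in})² ≥ 0` in `two_mul_integral_mul_generator_eq_neg_carre`). [cite: ShenZhuZhu2022, §3 (p. 13)] -/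
theorem integral_mul_generator_self_nonpos (L : ℕ) [NeZero L] (β' : ℝ)
    {f : (Edge 3 L × Fin 2 × Fin 2 × Bool → ℝ) → ℝ} (hf : ContDiff ℝ 3 f) (hfc : HasCompactSupport f) :
    let coords : GaugeConfig 3 L (Matrix.specialUnitaryGroup (Fin 2) ℂ) → (Edge 3 L × Fin 2 × Fin 2 × Bool → ℝ) :=
      fun V q => (fun z : ℂ => if q.2.2.2 then z.im else z.re)
        ((fundamentalRep (Fin 2) (V q.1) : Matrix (Fin 2) (Fin 2) ℂ) q.2.1 q.2.2.1)
    let gen : GaugeConfig 3 L (Matrix.specialUnitaryGroup (Fin 2) ℂ) → ℝ := fun V =>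
      (∑ i : Edge 3 L × Fin 2 × Fin 2 × Bool, fderiv ℝ f (coords V) (Pi.single i 1) *
          (fun z : ℂ => if i.2.2.2 then z.im else z.re)
            ((latticeLangevinDynamics (fundamentalLatticeRep 2) β').drift
              (matrixConfig (fundamentalRep (Fin 2)) V) i.1 i.2.1 i.2.2.1) +
      1 / 2 * ∑ i : Edge 3 L × Fin 2 × Fin 2 × Bool, ∑ j : Edge 3 L × Fin 2 × Fin 2 × Bool,
        fderiv ℝ (fun z => fderiv ℝ f z (Pi.single i 1)) (coords V) (Pi.single j 1) *
          ∑ n : Edge 3 L × NoiseIdx 2,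
            (if n.1 = i.1 then (fun z : ℂ => if i.2.2.2 then z.im else z.re)
              ((latticeLangevinDynamics (fundamentalLatticeRep 2) β').noise
                (matrixConfig (fundamentalRep (Fin 2)) V) i.1 n.2 i.2.1 i.2.2.1) else 0) *
            (if n.1 = j.1 then (fun z : ℂ => if j.2.2.2 then z.im else z.re)
              ((latticeLangevinDynamics (fundamentalLatticeRep 2) β').noise
                (matrixConfig (fundamentalRep (Fin 2)) V) j.1 n.2 j.2.1 j.2.2.1) else 0))
    ∫ V, f (coords V) * gen V ∂(wilsonMeasure (d := 3) (L := L) (fundamentalRep (Fin 2)) β') ≤ 0 := by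
  intro coords gen
  classical
  have h := two_mul_integral_mul_generator_eq_neg_carre L β' hf hfc
  -- the carré du champ is a sum of squares
  have hΓ : ∀ V : GaugeConfig 3 L (Matrix.specialUnitaryGroup (Fin 2) ℂ),
      0 ≤ ∑ i : Edge 3 L × Fin 2 × Fin 2 × Bool, ∑ j : Edge 3 L × Fin 2 × Fin 2 × Bool,
        fderiv ℝ f (coords V) (Pi.single i 1) * fderiv ℝ f (coords V) (Pi.single j 1) *
          ∑ n : Edge 3 L × NoiseIdx 2,
            (if n.1 = i.1 then (fun z : ℂ => if i.2.2.2 then z.im else z.re)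
              ((latticeLangevinDynamics (fundamentalLatticeRep 2) β').noise
                (matrixConfig (fundamentalRep (Fin 2)) V) i.1 n.2 i.2.1 i.2.2.1) else 0) *
            (if n.1 = j.1 then (fun z : ℂ => if j.2.2.2 then z.im else z.re)
              ((latticeLangevinDynamics (fundamentalLatticeRep 2) β').noise
                (matrixConfig (fundamentalRep (Fin 2)) V) j.1 n.2 j.2.1 j.2.2.1) else 0) := by
    intro V
    set a : (Edge 3 L × Fin 2 × Fin 2 × Bool) → ℝ := fun i => fderiv ℝ f (coords V) (Pi.single i 1) with ha
    set σ : (Edge 3 L × Fin 2 × Fin 2 × Bool) → (Edge 3 L × NoiseIdx 2) → ℝ := fun i n =>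
      if n.1 = i.1 then (fun z : ℂ => if i.2.2.2 then z.im else z.re)
        ((latticeLangevinDynamics (fundamentalLatticeRep 2) β').noise
          (matrixConfig (fundamentalRep (Fin 2)) V) i.1 n.2 i.2.1 i.2.2.1) else 0 with hσ
    have hre : ∑ i, ∑ j, a i * a j * ∑ n, σ i n * σ j n = ∑ n, (∑ i, a i * σ i n) ^ 2 := by
      have h1 : ∀ n, (∑ i, a i * σ i n) ^ 2 = ∑ i, ∑ j, a i * σ i n * (a j * σ j n) := fun n => by
        rw [sq, Finset.sum_mul_sum]
      simp_rw [h1, Finset.mul_sum]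
      -- LHS `∑ i, ∑ j, ∑ n`, RHS `∑ n, ∑ i, ∑ j`: bring `n` inside on the right
      conv_rhs => rw [Finset.sum_comm]
      refine Finset.sum_congr rfl fun i _ => ?_
      conv_rhs => rw [Finset.sum_comm]
      refine Finset.sum_congr rfl fun j _ => ?_
      exact Finset.sum_congr rfl fun n _ => by ring
    show 0 ≤ ∑ i, ∑ j, a i * a j * ∑ n, σ i n * σ j n
    rw [hre]
    exact Finset.sum_nonneg fun n _ => sq_nonneg _
  have hI : 0 ≤ ∫ V, (∑ i : Edge 3 L × Fin 2 × Fin 2 × Bool, ∑ j : Edge 3 L × Fin 2 × Fin 2 × Bool,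
        fderiv ℝ f (coords V) (Pi.single i 1) * fderiv ℝ f (coords V) (Pi.single j 1) *
          ∑ n : Edge 3 L × NoiseIdx 2,
            (if n.1 = i.1 then (fun z : ℂ => if i.2.2.2 then z.im else z.re)
              ((latticeLangevinDynamics (fundamentalLatticeRep 2) β').noise
                (matrixConfig (fundamentalRep (Fin 2)) V) i.1 n.2 i.2.1 i.2.2.1) else 0) *
            (if n.1 = j.1 then (fun z : ℂ => if j.2.2.2 then z.im else z.re)
              ((latticeLangevinDynamics (fundamentalLatticeRep 2) β').noise
                (matrixConfig (fundamentalRep (Fin 2)) V) j.1 n.2 j.2.1 j.2.2.1) else 0))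
        ∂(wilsonMeasure (d := 3) (L := L) (fundamentalRep (Fin 2)) β') :=
    integral_nonneg hΓ
  have h' : 2 * ∫ V, f (coords V) * gen V ∂(wilsonMeasure (d := 3) (L := L) (fundamentalRep (Fin 2)) β') =
      -∫ V, (∑ i : Edge 3 L × Fin 2 × Fin 2 × Bool, ∑ j : Edge 3 L × Fin 2 × Fin 2 × Bool,
        fderiv ℝ f (coords V) (Pi.single i 1) * fderiv ℝ f (coords V) (Pi.single j 1) *
          ∑ n : Edge 3 L × NoiseIdx 2,
            (if n.1 = i.1 then (fun z : ℂ => if i.2.2.2 then z.im else z.re)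
              ((latticeLangevinDynamics (fundamentalLatticeRep 2) β').noise
                (matrixConfig (fundamentalRep (Fin 2)) V) i.1 n.2 i.2.1 i.2.2.1) else 0) *
            (if n.1 = j.1 then (fun z : ℂ => if j.2.2.2 then z.im else z.re)
              ((latticeLangevinDynamics (fundamentalLatticeRep 2) β').noise
                (matrixConfig (fundamentalRep (Fin 2)) V) j.1 n.2 j.2.1 j.2.2.1) else 0))
        ∂(wilsonMeasure (d := 3) (L := L) (fundamentalRep (Fin 2)) β') := h
  linarith

/-- ★ **The Dirichlet form of the semigroup on smooth cylinder functions**: for a `C³` compactly supported `f`, `F = f∘coords`,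
and any realising kernel family, `τ⁻¹ (∫ F · κ_τ F dμ_{β'} - ∫ F² dμ_{β'}) → ∫ F · 𝓛f dμ_{β'}` as `τ ↓ 0`; i.e.
`𝓔(F) := lim_{τ↓0} τ⁻¹ ⟨F - P_τ F, F⟩_μ = -∫ F 𝓛F dμ = ½ ∫ Γ(f,f) dμ ≥ 0`. [cite: ShenZhuZhu2022, §3 (p. 13)] -/
theorem tendsto_dirichletForm_semigroup (L : ℕ) [NeZero L] (β' : ℝ)
    (κ : ℝ≥0 → Kernel (GaugeConfig 3 L (Matrix.specialUnitaryGroup (Fin 2) ℂ))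
      (GaugeConfig 3 L (Matrix.specialUnitaryGroup (Fin 2) ℂ))) [∀ t, IsMarkovKernel (κ t)]
    (hreal : ∀ (t : ℝ≥0) (x : GaugeConfig 3 L (Matrix.specialUnitaryGroup (Fin 2) ℂ))
        (Ω : Type) [MeasurableSpace Ω] (P : Measure Ω) [IsProbabilityMeasure P]
        (W : ℝ≥0 → Ω → (Edge 3 L × NoiseIdx 2 → ℝ)) (hW : IsFlatBrownian W P)
        (U : ℝ≥0 → Ω → GaugeConfig 3 L (Matrix.specialUnitaryGroup (Fin 2) ℂ)),
        (∀ ω, U 0 ω = x) →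
        (latticeLangevinDynamics (fundamentalLatticeRep 2) β').IsSolution (fundamentalRep (Fin 2))
          hW.natFiltration P W U →
        κ t x = P.map (U t))
    {f : (Edge 3 L × Fin 2 × Fin 2 × Bool → ℝ) → ℝ} (hf : ContDiff ℝ 3 f) (hfc : HasCompactSupport f) :
    let coords : GaugeConfig 3 L (Matrix.specialUnitaryGroup (Fin 2) ℂ) → (Edge 3 L × Fin 2 × Fin 2 × Bool → ℝ) :=
      fun V q => (fun z : ℂ => if q.2.2.2 then z.im else z.re)
        ((fundamentalRep (Fin 2) (V q.1) : Matrix (Fin 2) (Fin 2) ℂ) q.2.1 q.2.2.1)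
    let gen : GaugeConfig 3 L (Matrix.specialUnitaryGroup (Fin 2) ℂ) → ℝ := fun V =>
      (∑ i : Edge 3 L × Fin 2 × Fin 2 × Bool, fderiv ℝ f (coords V) (Pi.single i 1) *
          (fun z : ℂ => if i.2.2.2 then z.im else z.re)
            ((latticeLangevinDynamics (fundamentalLatticeRep 2) β').drift
              (matrixConfig (fundamentalRep (Fin 2)) V) i.1 i.2.1 i.2.2.1) +
      1 / 2 * ∑ i : Edge 3 L × Fin 2 × Fin 2 × Bool, ∑ j : Edge 3 L × Fin 2 × Fin 2 × Bool,
        fderiv ℝ (fun z => fderiv ℝ f z (Pi.single i 1)) (coords V) (Pi.single j 1) *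
          ∑ n : Edge 3 L × NoiseIdx 2,
            (if n.1 = i.1 then (fun z : ℂ => if i.2.2.2 then z.im else z.re)
              ((latticeLangevinDynamics (fundamentalLatticeRep 2) β').noise
                (matrixConfig (fundamentalRep (Fin 2)) V) i.1 n.2 i.2.1 i.2.2.1) else 0) *
            (if n.1 = j.1 then (fun z : ℂ => if j.2.2.2 then z.im else z.re)
              ((latticeLangevinDynamics (fundamentalLatticeRep 2) β').noise
                (matrixConfig (fundamentalRep (Fin 2)) V) j.1 n.2 j.2.1 j.2.2.1) else 0))
    Tendsto (fun τ : ℝ => τ⁻¹ * ((∫ V, f (coords V) * (∫ y, f (coords y) ∂(κ τ.toNNReal V))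
        ∂(wilsonMeasure (d := 3) (L := L) (fundamentalRep (Fin 2)) β')) -
        ∫ V, f (coords V) * f (coords V) ∂(wilsonMeasure (d := 3) (L := L) (fundamentalRep (Fin 2)) β')))
      (𝓝[>] 0) (𝓝 (∫ V, f (coords V) * gen V ∂(wilsonMeasure (d := 3) (L := L) (fundamentalRep (Fin 2)) β'))) := by
  intro coords gen
  classical
  haveI := secondCountableTopology_su2
  haveI := borelSpace_config L
  set μ : Measure (GaugeConfig 3 L (Matrix.specialUnitaryGroup (Fin 2) ℂ)) :=
    wilsonMeasure (d := 3) (L := L) (fundamentalRep (Fin 2)) β' with hμ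
  haveI : IsProbabilityMeasure μ :=
    isProbabilityMeasure_wilsonMeasure (d := 3) (L := L) (fundamentalRep (Fin 2)) (continuous_fundamentalRep (Fin 2)) β'
  have hco : Continuous coords := continuous_coords (L := L)
  have hFc : Continuous fun V => f (coords V) := hf.continuous.comp hco
  have hgf : Continuous gen := continuous_generator (L := L) β' (hf.of_le (by norm_num))
  have hDf : ∀ x, ∀ {τ : ℝ}, 0 ≤ τ →
      ∫ y, f (coords y) ∂(κ τ.toNNReal x) = f (coords x) + ∫ r in (0 : ℝ)..τ, (∫ y, gen y ∂(κ r.toNNReal x)) :=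
    fun x τ hτ => transitionKernel_dynkin (L := L) β' κ hreal hf hfc x hτ
  have hJ : Continuous (Function.uncurry fun (r : ℝ) (x : GaugeConfig 3 L (Matrix.specialUnitaryGroup (Fin 2) ℂ)) =>
      f (coords x) * ∫ y, gen y ∂(κ r.toNNReal x)) :=
    (hFc.comp continuous_snd).mul ((continuous_transitionKernel_action β' κ hreal hgf).comp
      ((continuous_real_toNNReal.comp continuous_fst).prodMk continuous_snd))
  set φ : ℝ → ℝ := fun r => ∫ x, f (coords x) * ∫ y, gen y ∂(κ r.toNNReal x) ∂μ with hφ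
  have hφc : Continuous φ := continuous_integral_of_continuous_uncurry μ hJ
  -- `∫ F κ_τ F dμ - ∫ F² dμ = ∫₀^τ φ` for `τ > 0`
  have hkey : ∀ τ : ℝ, 0 < τ → (∫ V, f (coords V) * (∫ y, f (coords y) ∂(κ τ.toNNReal V)) ∂μ) -
      ∫ V, f (coords V) * f (coords V) ∂μ = ∫ r in (0 : ℝ)..τ, φ r := by
    intro τ hτ
    have hI : Continuous fun x : GaugeConfig 3 L (Matrix.specialUnitaryGroup (Fin 2) ℂ) =>
        ∫ r in (0 : ℝ)..τ, f (coords x) * ∫ y, gen y ∂(κ r.toNNReal x) := by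
      have h' : Continuous (Function.uncurry fun (x : GaugeConfig 3 L (Matrix.specialUnitaryGroup (Fin 2) ℂ)) (r : ℝ) =>
          f (coords x) * ∫ y, gen y ∂(κ r.toNNReal x)) := hJ.comp continuous_swap
      exact intervalIntegral.continuous_parametric_intervalIntegral_of_continuous' h' 0 τ
    have hpt : ∀ x, f (coords x) * (∫ y, f (coords y) ∂(κ τ.toNNReal x)) =
        f (coords x) * f (coords x) + ∫ r in (0 : ℝ)..τ, f (coords x) * ∫ y, gen y ∂(κ r.toNNReal x) := by
      intro x; rw [hDf x hτ.le, mul_add, intervalIntegral.integral_const_mul]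
    rw [integral_congr_ae (Eventually.of_forall hpt), integral_add (integrable_of_continuous_of_compactSpace (f := fun V => f (coords V) * f (coords V)) (hFc.mul hFc) μ)
      (integrable_of_continuous_of_compactSpace hI μ), integral_intervalIntegral_swap_of_continuous μ hJ hτ.le]
    ring
  have hlim := tendsto_inv_mul_intervalIntegral_of_continuous hφc
  have hφ0 : φ 0 = ∫ V, f (coords V) * gen V ∂μ := by
    refine integral_congr_ae (Eventually.of_forall fun x => ?_)
    have hx : ∫ y, gen y ∂(κ (0 : ℝ).toNNReal x) = gen x := by
      have h := hDf x (le_refl 0)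
      -- at `τ = 0` Dynkin reads `κ_0 F = F`; use instead the realisation: `κ 0 x = δ_x`
      have hsol : κ (0 : ℝ).toNNReal x = Measure.dirac x := by
        haveI := isProbabilityMeasure_piWiener (Edge 3 L × NoiseIdx 2)
        have hWc := isFlatBrownian_piWiener 3 L (NoiseIdx 2)
        obtain ⟨U, hU0, hU⟩ := solution_from_start hWc β' x
        rw [Real.toNNReal_zero, hreal 0 x _ _ _ hWc U hU0 hU]
        have hU0' : U 0 = fun _ => x := funext hU0
        rw [hU0', Measure.map_const, measure_univ, one_smul]
      rw [hsol, integral_dirac]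
    simp only [hx]
  rw [← hφ0]
  refine hlim.congr' ?_
  filter_upwards [self_mem_nhdsWithin] with τ hτ
  rw [hkey τ hτ]

end Summit.QuantumFields.YangMills.Theorems.ColdStartUniversality

end
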